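import Summits.QuantumFields.Balaban3D.Carriers.RadialForest
import Summits.QuantumFields.Balaban3D.Carriers.RadialContour
import Literature.MathematicalPhysics.QuantumFieldTheory.Balaban1983to89.AveragingReflection

/-!
# Lane `pub-balaban3d` — carrier layer p1 (`Carriers.RadialIdent`): ONE AXIAL GAUGE (ruling R-FOREST, part 2) — the contours `Γ_{y,x}`
# of `Carriers.RadialContour` run inside the radial forest of `Carriers.RadialForest`: after setting the forest bonds of the blocks
# over `Ω` to `1`, EVERY contour holonomy `U(Γ_{y,x})`, `y ∈ Ω`, `x ∈ B(y)`, equals `1`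

I.e. the gauge-fixed configuration `U[radialBonds Ω := 1]` of (10) (`Carriers.Formula10`) lies in the axial gauge `δ_{Ax(Ω)}` of (9)
(`U(Γ_{y,x}) = 1 for x ∈ B(y)`, [Balaban1985UV3] p. 258 L12–13) for the SAME contour system `radialContourData` over which (9) is stated.
[folklore] torus combinatorics (standing range `j + 1 ≤ m + K`); nothing of CMP 102 is asserted.
-/

namespace Summit.QuantumFields.Balaban3D.Carriers

open Literature.MathematicalPhysics.QuantumFieldTheory.Balaban1983to89
open Literature.MathematicalPhysics.QuantumFieldTheory.Balaban1983to89.T4TreeGaugeFixing (fixTo fixTo_apply_of_mem)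
open Literature.MathematicalPhysics.QuantumFieldTheory.Balaban1983to89.AveragingReflection (two_mul_L_le_sitesPerDir)

variable {P : Params} {j : ℕ} {G : Type*} [GaugeGroup G]

/-! ## §1 Segments all of whose bonds carry `1` transport trivially -/

/-- A forward segment whose bonds all carry `1` has holonomy `1`. [folklore] -/
theorem fwdHol_eq_one (U : GaugeField P j G) (μ : Fin P.d) :
    ∀ (n : ℕ) (z : Site P j), (∀ i, i < n → U ⟨shiftN z μ i, μ⟩ = 1) → fwdHol U μ n z = 1
  | 0, _, _ => rfl
  | n + 1, z, h => by
    have h0 : U ⟨z, μ⟩ = 1 := h 0 (Nat.succ_pos n)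
    have ht : fwdHol U μ n (z.shift μ) = 1 := fwdHol_eq_one U μ n (z.shift μ) fun i hi => h (i + 1) (by omega)
    simp [fwdHol, h0, ht]

/-- A backward segment whose bonds all carry `1` has holonomy `1`. [folklore] -/
theorem bwdHol_eq_one (U : GaugeField P j G) (μ : Fin P.d) :
    ∀ (n : ℕ) (z : Site P j), (∀ i, i < n → U ⟨unshiftN z μ (i + 1), μ⟩ = 1) → bwdHol U μ n z = 1
  | 0, _, _ => rfl
  | n + 1, z, h => by
    have h0 : U ⟨z.unshift μ, μ⟩ = 1 := h 0 (Nat.succ_pos n)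
    have ht : bwdHol U μ n (z.unshift μ) = 1 := bwdHol_eq_one U μ n (z.unshift μ) fun i hi => h (i + 1) (by omega)
    simp [bwdHol, h0, ht]

/-! ## §2 Label arithmetic inside a block (standing range) -/

section Labels

/-- Label of a site of the block over `y`: `(x_μ) = n L + off`, `n` = label of `y_μ`. [folklore] -/
theorem val_eq_of_blockOf (hj : j + 1 ≤ P.m + P.K) {x : Site P j} {y : Site P (j + 1)} (hx : blockOf x = y) (μ : Fin P.d) :
    (x μ).val = (y μ).val * P.L + off x μ := by
  have h1 : ((blockOf x) μ).val = (x μ).val / P.L := Site.val_blockOf hj x μ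
  rw [hx] at h1
  unfold off
  have := Nat.div_add_mod (x μ).val P.L
  rw [← h1] at this
  linarith [this, Nat.mul_comm P.L (y μ).val]

/-- Sites are equal iff their labels are. [folklore] -/
theorem site_apply_eq_iff {x z : Site P j} {μ : Fin P.d} : x μ = z μ ↔ (x μ).val = (z μ).val :=
  ⟨fun h => by rw [h], fun h => ZMod.val_injective _ h⟩

end Labels

/-! ## §3 The bonds of `Γ_{y,x}` lie in the radial forest; holonomies of the gauge-fixed configuration vanish -/

section Ident

/-- THE FORWARD HALF-SEGMENT IS IN THE FOREST: from a site `z ∈ B(y)` at the centre below `μ`, with offset `h ≤ off_μ z`, the bonds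
`⟨z + i e_μ, μ⟩`, `off_μ z + i < L − 1`, belong to `radialBonds {y}`. [folklore] -/
theorem shiftN_mem_radialBonds (hj : j + 1 ≤ P.m + P.K) {y : Site P (j + 1)} {z : Site P j} (hz : blockOf z = y)
    {μ : Fin P.d} (hlow : ∀ κ, κ < μ → off z κ = (P.L - 1) / 2) (i : ℕ) (hi : off z μ + i < P.L - 1) :
    (⟨shiftN z μ i, μ⟩ : PBond P j) ∈ radialBonds ({y} : Finset (Site P (j + 1))) := by
  have hL := P.hL.2
  have hN := two_mul_L_le_sitesPerDir hj
  have hzv := val_eq_of_blockOf hj hz μ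
  have hy : (y μ).val + 1 ≤ P.sitesPerDir (j + 1) := ZMod.val_lt (y μ)
  have hNN : P.sitesPerDir j = P.sitesPerDir (j + 1) * P.L := P.sitesPerDir_eq_mul_succ hj
  have hoff : off z μ < P.L := off_lt z μ
  -- the label of the shifted coordinate
  have hval : ((shiftN z μ i) μ).val = (y μ).val * P.L + (off z μ + i) := by
    rw [shiftN_eq]
    simp only [Function.update_self]
    -- adding `i` to a label `< N − i` does not wrap
    have hlt : (z μ).val + i < P.sitesPerDir j := by
      rw [hzv, hNN]
      have : ((y μ).val + 1) * P.L ≤ P.sitesPerDir (j + 1) * P.L := Nat.mul_le_mul_right _ hy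
      rw [Nat.add_mul, one_mul] at this
      omega
    have hiv : ((i : ZMod (P.sitesPerDir j))).val = i := by rw [ZMod.val_natCast, Nat.mod_eq_of_lt (by omega)]
    rw [ZMod.val_add_of_lt (by rw [hiv]; exact hlt), hiv, hzv]
    ring
  have hother : ∀ κ, κ ≠ μ → (shiftN z μ i) κ = z κ := fun κ hκ => by
    rw [shiftN_eq]; simp [Function.update_of_ne hκ]
  rw [mem_radialBonds]
  refine ⟨?_, ?_, ?_⟩
  · -- same block
    rw [Finset.mem_singleton]
    funext κ
    apply ZMod.val_injective
    rw [Site.val_blockOf hj]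
    by_cases hκ : κ = μ
    · subst hκ
      show ((shiftN z κ i) κ).val / P.L = (y κ).val
      rw [hval, Nat.mul_comm, Nat.mul_add_div P.L_pos, Nat.div_eq_of_lt (by omega), add_zero]
    · show ((shiftN z μ i) κ).val / P.L = (y κ).val
      rw [hother κ hκ, ← Site.val_blockOf hj, hz]
  · -- offset along μ
    show ((shiftN z μ i) μ).val % P.L < P.L - 1
    rw [hval, Nat.mul_comm, Nat.mul_add_mod, Nat.mod_eq_of_lt (by omega)]
    exact hi
  · intro κ hκ
    show ((shiftN z μ i) κ).val % P.L = (P.L - 1) / 2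
    rw [hother κ (ne_of_lt hκ)]
    exact hlow κ hκ

/-- THE BACKWARD HALF-SEGMENT IS IN THE FOREST: from `z ∈ B(y)` at the centre below `μ`, the bonds `⟨z − (i+1) e_μ, μ⟩`, `i + 1 ≤ off_μ z`,
belong to `radialBonds {y}` (their offset is `off_μ z − i − 1 ≤ (L−1)/2 − 1 < L − 1` when `off_μ z ≤ (L−1)/2`). [folklore] -/
theorem unshiftN_mem_radialBonds (hj : j + 1 ≤ P.m + P.K) {y : Site P (j + 1)} {z : Site P j} (hz : blockOf z = y)
    {μ : Fin P.d} (hlow : ∀ κ, κ < μ → off z κ = (P.L - 1) / 2) (hzμ : off z μ ≤ (P.L - 1) / 2) (i : ℕ) (hi : i + 1 ≤ off z μ) :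
    (⟨unshiftN z μ (i + 1), μ⟩ : PBond P j) ∈ radialBonds ({y} : Finset (Site P (j + 1))) := by
  have hL := P.hL.2
  have hzv := val_eq_of_blockOf hj hz μ
  have hval : ((unshiftN z μ (i + 1)) μ).val = (y μ).val * P.L + (off z μ - (i + 1)) := by
    rw [unshiftN_eq]
    simp only [Function.update_self]
    rw [show (z μ - ((i + 1 : ℕ) : ZMod (P.sitesPerDir j))) = z μ - (((i + 1 : ℕ)) : ZMod (P.sitesPerDir j)) from rfl]
    -- subtracting `i + 1 ≤ label` does not wrap
    have hle : i + 1 ≤ (z μ).val := by rw [hzv]; omega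
    have hiv : (((i + 1 : ℕ) : ZMod (P.sitesPerDir j))).val = i + 1 := by
      rw [ZMod.val_natCast, Nat.mod_eq_of_lt (lt_of_le_of_lt hle (ZMod.val_lt _))]
    rw [ZMod.val_sub (by rw [hiv]; exact hle), hiv, hzv]
    omega
  have hother : ∀ κ, κ ≠ μ → (unshiftN z μ (i + 1)) κ = z κ := fun κ hκ => by
    rw [unshiftN_eq]; simp [Function.update_of_ne hκ]
  rw [mem_radialBonds]
  refine ⟨?_, ?_, ?_⟩
  · rw [Finset.mem_singleton]
    funext κ
    apply ZMod.val_injective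
    rw [Site.val_blockOf hj]
    by_cases hκ : κ = μ
    · subst hκ
      show ((unshiftN z κ (i + 1)) κ).val / P.L = (y κ).val
      rw [hval, Nat.mul_comm, Nat.mul_add_div P.L_pos, Nat.div_eq_of_lt (by omega), add_zero]
    · show ((unshiftN z μ (i + 1)) κ).val / P.L = (y κ).val
      rw [hother κ hκ, ← Site.val_blockOf hj, hz]
  · show ((unshiftN z μ (i + 1)) μ).val % P.L < P.L - 1
    rw [hval, Nat.mul_comm, Nat.mul_add_mod, Nat.mod_eq_of_lt (by omega)]
    omega
  · intro κ hκ
    show ((unshiftN z μ (i + 1)) κ).val % P.L = (P.L - 1) / 2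
    rw [hother κ (ne_of_lt hκ)]
    exact hlow κ hκ

variable [DecidableEq (PBond P j)]

/-- ONE COORDINATE MOVE of `Γ_{y,x}` inside the block has trivial holonomy once the forest of `B(y)` carries `1`: from `z ∈ B(y)` at the
centre in the coordinates `≤ μ`, moving the coordinate `μ` to that of `x ∈ B(y)`. [folklore] -/
theorem moveHol_eq_one (hj : j + 1 ≤ P.m + P.K) {T : Finset (PBond P j)} {y : Site P (j + 1)}
    (hT : radialBonds ({y} : Finset (Site P (j + 1))) ⊆ T) (U : GaugeField P j G) {z x : Site P j}
    (hz : blockOf z = y) (hx : blockOf x = y) {μ : Fin P.d} (hlow : ∀ κ, κ < μ → off z κ = (P.L - 1) / 2)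
    (hzμ : off z μ = (P.L - 1) / 2) :
    moveHol (fixTo T 1 U) μ (x μ) z = 1 := by
  have hL := P.hL.2
  have hN := two_mul_L_le_sitesPerDir hj
  have hzv := val_eq_of_blockOf hj hz μ
  have hxv := val_eq_of_blockOf hj hx μ
  have hsx : off x μ < P.L := off_lt x μ
  have hone : ∀ b ∈ T, fixTo T 1 U b = 1 := fun b hb => by rw [fixTo_apply_of_mem hb]; rfl
  unfold moveHol
  by_cases hcase : (P.L - 1) / 2 ≤ off x μ
  · -- forward: x_μ − z_μ has label off x − h ≤ (L−1)/2 ≤ N − (off x − h)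
    have hsub : (x μ - z μ).val = off x μ - (P.L - 1) / 2 := by
      rw [ZMod.val_sub (by rw [hxv, hzv]; omega), hxv, hzv]; omega
    have hle : (x μ - z μ).val ≤ (z μ - x μ).val := by
      by_cases heq : x μ = z μ
      · simp [heq]
      · have hne : x μ - z μ ≠ 0 := sub_ne_zero.mpr heq
        have : (z μ - x μ) = -(x μ - z μ) := by ring
        rw [this, ZMod.neg_val, if_neg hne, hsub]
        omega
    rw [if_pos hle, hsub]
    refine fwdHol_eq_one _ _ _ _ fun i hi => hone _ (hT ?_)
    exact shiftN_mem_radialBonds hj hz hlow i (by omega)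
  · -- backward: z_μ − x_μ has label h − off x
    rw [not_le] at hcase
    have hsub : (z μ - x μ).val = (P.L - 1) / 2 - off x μ := by
      rw [ZMod.val_sub (by rw [hxv, hzv]; omega), hxv, hzv]; omega
    have hne : z μ - x μ ≠ 0 := by
      intro h0
      have : (z μ - x μ).val = 0 := by rw [h0, ZMod.val_zero]
      omega
    have hgt : ¬ (x μ - z μ).val ≤ (z μ - x μ).val := by
      have : (x μ - z μ) = -(z μ - x μ) := by ring
      rw [this, ZMod.neg_val, if_neg hne, hsub]
      omega
    rw [if_neg hgt, hsub]
    refine bwdHol_eq_one _ _ _ _ fun i hi => hone _ (hT ?_)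
    exact unshiftN_mem_radialBonds hj hz hlow (by omega) i (by omega)

/-- THE WHOLE CONTOUR: along a decreasing, downward-closed list of coordinates, starting from a site of `B(y)` which sits at the centre in
the listed coordinates, the path to `x ∈ B(y)` has trivial holonomy for the gauge-fixed configuration. [folklore] -/
theorem pathHol_eq_one (hj : j + 1 ≤ P.m + P.K) {T : Finset (PBond P j)} {y : Site P (j + 1)}
    (hT : radialBonds ({y} : Finset (Site P (j + 1))) ⊆ T) (U : GaugeField P j G) {x : Site P j} (hx : blockOf x = y) :
    ∀ (l : List (Fin P.d)), l.Pairwise (· > ·) → (∀ μ ∈ l, ∀ κ, κ < μ → κ ∈ l) →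
      ∀ z : Site P j, blockOf z = y → (∀ κ ∈ l, off z κ = (P.L - 1) / 2) → pathHol (fixTo T 1 U) x l z = 1
  | [], _, _, _, _, _ => rfl
  | μ :: l, hsort, hclosed, z, hz, hctr => by
    rw [List.pairwise_cons] at hsort
    have hlowμ : ∀ κ, κ < μ → off z κ = (P.L - 1) / 2 := fun κ hκ =>
      hctr κ (hclosed μ (List.mem_cons_self) κ hκ)
    have hmove := moveHol_eq_one hj hT U hz hx hlowμ (hctr μ (List.mem_cons_self))
    simp only [pathHol, hmove, one_mul]
    -- the next point: `z` with coordinate `μ` set to `x μ`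
    refine pathHol_eq_one hj hT U hx l hsort.2 ?_ (Function.update z μ (x μ)) ?_ ?_
    · intro μ' hμ' κ hκ
      have hκl : κ ∈ μ :: l := hclosed μ' (List.mem_cons_of_mem _ hμ') κ hκ
      rcases List.mem_cons.1 hκl with rfl | h
      · exact absurd (hsort.1 μ' hμ') (by omega)
      · exact h
    · funext κ
      apply ZMod.val_injective
      rw [Site.val_blockOf hj]
      by_cases hκ : κ = μ
      · subst hκ; simp only [Function.update_self]; rw [← Site.val_blockOf hj, hx]
      · rw [Function.update_of_ne hκ, ← Site.val_blockOf hj, hz]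
    · intro κ hκ
      have hne : κ ≠ μ := fun h => by subst h; exact absurd (hsort.1 κ hκ) (lt_irrefl _)
      unfold off; rw [Function.update_of_ne hne]; exact hctr κ (List.mem_cons_of_mem _ hκ)

/-- **ONE AXIAL GAUGE.**  For `y ∈ Ω` and `x ∈ B(y)`: the contour holonomy `U(Γ_{y,x})` of the GAUGE-FIXED configuration
`U[radialBonds Ω := 1]` is `1` — i.e. `fixTo (radialBonds Ω) 1 U` satisfies the axial gauge condition `δ_{Ax(y)}` of (9)
([Balaban1985UV3] p. 258) for the contour system `radialContourData` of (1.7).  Standing range. [cite: Balaban1985UV3, (9) p.258] -/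
theorem radialHol_fixTo_eq_one (hj : j + 1 ≤ P.m + P.K) (Ω : Finset (Site P (j + 1))) (U : GaugeField P j G)
    {y : Site P (j + 1)} (hy : y ∈ Ω) {x : Site P j} (hx : blockOf x = y) :
    radialHol (fixTo (radialBonds Ω) 1 U) y x = 1 := by
  unfold radialHol
  refine pathHol_eq_one hj (radialBonds_mono (Finset.singleton_subset_iff.2 hy)) U hx (coordsDesc P) ?_ ?_ (emb y)
    (Site.blockOf_emb hj y) ?_
  · -- `coordsDesc` is strictly decreasing
    unfold coordsDesc
    rw [List.pairwise_reverse]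
    exact (List.pairwise_lt_finRange P.d)
  · intro μ _ κ _; simp [coordsDesc]
  · intro κ _; exact off_emb hj y κ

/-- The same through the `ContourData` interface: `(radialContourData).holTo (U[radialBonds Ω := 1]) y x = 1` for `y ∈ Ω`, `x ∈ B(y)`.
[cite: Balaban1985UV3, (9) p.258] -/
theorem radialContourData_holTo_fixTo (hj : j + 1 ≤ P.m + P.K) (Ω : Finset (Site P (j + 1))) (U : GaugeField P j G)
    {y : Site P (j + 1)} (hy : y ∈ Ω) {x : Site P j} (hx : blockOf x = y) :
    (radialContourData P j G).holTo (fixTo (radialBonds Ω) 1 U) y x = 1 :=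
  radialHol_fixTo_eq_one hj Ω U hy hx

end Ident

end Summit.QuantumFields.Balaban3D.Carriers
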